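import Literature.Barriers.CriticalPhenomena.RigorousRGSmallParameterPolymerGas
import HarnessLib

/-!
# `RigorousRGSmallParameter` (Slade, Theorem 1.4.1): the binomial lemma `(F₁+F₂)^X = (F₁ ∘ F₂)(X)`,
# Map 2, the closure `X̄`, and the reblocking identity of Map 3 ([BS-rg-step] §1.5, §4.3, §5.1)

Companion ("proof architecture") file of
`Literature/Barriers/CriticalPhenomena/RigorousRGSmallParameter.lean`. The renormalisation-group
map `(V,K) ↦ (U₊,K₊)` of Slade's Theorem 6.3.1 (iterated in the named fact `Slade2017_prop822`)
is "defined in [BS-rg-step]" as the composition of six maps `K = K^{(0)} ↦ K^{(1)} ↦ ⋯ ↦ K^{(6)} = K₊`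
([BS-rg-step] §3.1), each step coming with an identity of circle products. This file proves the
purely algebraic identities of Maps 2 and 3 (activities with values in commutative rings; the
expectation enters Map 3 only through its linearity over fluctuation-free factors):

* **[BS-rg-step] Lemma (§1.5) `(F₁ + F₂)^X = (F₁ ∘ F₂)(X)`** ("By (B-extension), followed by
  expansion of the product and application of (circdef)"): `blockProd_add`.
* **Map 2** ([BS-rg-step] §4.3: "`I^{(2)} = Î = I_j(V̂)`, `δI^{(2)} = I - Î`, `K^{(2)} = K^{(1)} ∘ δI^{(2)}`";
  Lemma (lem:K2)(i) "`I ∘ K^{(1)} = (Î + δI) ∘ K^{(1)} = (Î ∘ δI) ∘ K^{(1)} = Î ∘ (δI ∘ K^{(1)})`"):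
  `circ_blockProd_eq_circ_blockProd_circ_sub`.
* Two scales `b ∣ b'` (`b = L^j`, `b' = L^{j+1}`): `block_subset_block_of_dvd`, `IsPolymer.of_dvd`;
  the closure "`X̄` of `X ∈ 𝒫_j` is the smallest `Y ∈ 𝒫_{j+1}` such that `X ⊂ Y`" and
  "`𝒫̄_j(U) = {X ∈ 𝒫_j : X̄ = U}`" ([BS-rg-step] §1.5, Definition (def:blocks1)): `bclosure`,
  `closureFiber`.
* **Map 3, [BS-rg-step] Proposition (prop:K3) (§5.1), the identity (EIK1)–(EIK2)**:
  "`𝔼₊θ(Î ∘ K^{(2)})(Λ) = (Ĩ_pt ∘ K^{(3)})(Λ)`, where, for `U ∈ 𝒫_{j+1}`,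
  `K^{(3)}(U) = Σ_{X ∈ 𝒫̄_j(U)} Ĩ_pt^{U∖X} 𝔼₊(δI ∘ θK^{(2)})(X)`", `δI = θÎ - Ĩ_pt`, with
  "`Ĩ_pt` … the element of ℬ𝒦_{j+1} defined for `B ∈ ℬ_{j+1}` by `Ĩ_pt(B) = ∏_{b ∈ ℬ_j(B)} Ĩ_pt(b)`":
  `deltaI`, **`kthree`**, **`expect_theta_circ_eq_circ_kthree`**. The proof is the printed one:
  "`θÎ(B) = Ĩ_pt(B) + δI(B)` and Lemma (lem:bin) … There is no `θ` operating on `Ĩ_pt`, and this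
  factor contains no fluctuation fields upon which `𝔼₊` can act … We write
  `X_I = \overline{X_K ∪ X_{δI}} ∖ (X_K ∪ X_{δI})` and `U = \overline{X_K ∪ X_{δI}}`". The operators are
  abstracted as ring maps `θ, ι : 𝒩 → 𝒩̃` (`θF(φ,ζ) = F(φ+ζ)`, `ιF(φ,ζ) = F(φ)`) and a map
  `E : 𝒩̃ → 𝒩` that is `𝒩`-linear on finite combinations `Σ ι(a_i) n_i` of admissible (`P`,
  i.e. integrable) elements — exactly the property used in the printed proof.

Not treated here: the component factorisation of `K^{(3)}` (needs the finite-range factorisation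
property (Efaczz) of `𝔼₊`), and all estimates (§5.2).

Sources: D. C. Brydges, G. Slade, J. Stat. Phys. 159 (2015) 589–667, arXiv:1403.7256 (TeX source;
its section numbering is used above): §1.5 (Lemma (lem:bin), Definition (def:blocks1)), §4.3
(Map 2), §5.1 (Proposition (prop:K3) and proof); G. Slade, arXiv:1611.06169, §6.1, §6.3.

## References

* [BrydgesSlade2015RGV] D. C. Brydges, G. Slade, *A renormalisation group method. V. A single
  renormalisation group step*, J. Stat. Phys. **159** (2015) 589–667, arXiv:1403.7256.
* [Slade2017] G. Slade, *Critical exponents for long-range O(n) models below the upper critical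
  dimension*, Commun. Math. Phys. **358** (2018) 343–436, arXiv:1611.06169.
-/

noncomputable section

open Finset

namespace Literature.Barriers.CriticalPhenomena

namespace LongRangePhi4

namespace Polymer

open Literature.Probability.LatticeModels

variable {d M : ℕ} [NeZero M]


/-! ## Block activities: the binomial lemma `(F₁ + F₂)^X = (F₁ ∘ F₂)(X)` and Map 2 -/

section Binomial

variable {R : Type*} [CommRing R] {b : ℕ}

/-- Blocks of a union of blocks of `X` are among those blocks. [folklore] -/
theorem blocksOf_biUnion_subset {X : Finset (TorusSite d M)} {T : Finset (Finset (TorusSite d M))}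
    (hT : T ⊆ blocksOf b X) : blocksOf b (T.biUnion id) = T := by
  classical
  ext B
  simp only [blocksOf, mem_image, mem_biUnion, id_eq]
  constructor
  · rintro ⟨y, ⟨B', hB', hyB'⟩, rfl⟩
    obtain ⟨x, -, rfl⟩ := exists_eq_block_of_mem_blocksOf (hT hB')
    rw [block_eq_of_mem hyB']
    exact hB'
  · intro hB
    obtain ⟨x, -, rfl⟩ := exists_eq_block_of_mem_blocksOf (hT hB)
    exact ⟨x, ⟨block b x, hB, mem_block_self b x⟩, rfl⟩

/-- A union of blocks is a polymer. [folklore] -/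
theorem isPolymer_biUnion_of_subset_blocksOf {X : Finset (TorusSite d M)} {T : Finset (Finset (TorusSite d M))}
    (hT : T ⊆ blocksOf b X) : IsPolymer b (T.biUnion id) := by
  classical
  intro y hy z hz
  obtain ⟨B, hB, hyB⟩ := mem_biUnion.1 hy
  obtain ⟨x, -, rfl⟩ := exists_eq_block_of_mem_blocksOf (hT hB)
  refine mem_biUnion.2 ⟨block b x, hB, ?_⟩
  rw [← block_eq_of_mem hyB]
  exact hz

/-- `ℬ(X ∖ Y) = ℬ(X) ∖ ℬ(Y)` for polymers `Y ⊆ X`. [folklore] -/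
theorem blocksOf_sdiff {X Y : Finset (TorusSite d M)} (hX : IsPolymer b X) (hY : IsPolymer b Y) (hYX : Y ⊆ X) :
    blocksOf b (X \ Y) = blocksOf b X \ blocksOf b Y := by
  have hu : blocksOf b X = blocksOf b Y ∪ blocksOf b (X \ Y) := by
    rw [← blocksOf_union, union_sdiff_of_subset hYX]
  have hd : Disjoint (blocksOf b Y) (blocksOf b (X \ Y)) := disjoint_blocksOf hY (hX.sdiff hY) disjoint_sdiff
  rw [hu, union_sdiff_left, sdiff_eq_self_of_disjoint hd.symm]

/-- **[BS-rg-step] Lemma 1.5.1 (binomial expansion and the circle product)**: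
`(F₁ + F₂)^X = (F₁ ∘ F₂)(X)` for block activities `F₁, F₂` and a polymer `X`, where
`F^X = ∏_{B ∈ ℬ(X)} F(B)`. [cite: BrydgesSlade2015RGV, §1.5, Lemma (lem:bin) "(F₁+F₂)^X = (F₁ ∘ F₂)(X)"] -/
theorem blockProd_add (F₁ F₂ : Finset (TorusSite d M) → R) {X : Finset (TorusSite d M)} (hX : IsPolymer b X) :
    blockProd b (F₁ + F₂) X = circ b (blockProd b F₁) (blockProd b F₂) X := by
  classical
  unfold blockProd circ
  simp only [Pi.add_apply]
  rw [Finset.prod_add]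
  -- subsets `T ⊆ ℬ(X)` ↔ sub-polymers `Y ⊆ X`
  refine Finset.sum_nbij' (fun T => T.biUnion id) (fun Y => blocksOf b Y) ?_ ?_ ?_ ?_ ?_
  · intro T hT
    rw [mem_powerset] at hT
    refine mem_subpolymers.2 ⟨?_, isPolymer_biUnion_of_subset_blocksOf hT⟩
    intro y hy
    obtain ⟨B, hB, hyB⟩ := mem_biUnion.1 hy
    exact subset_of_mem_blocksOf hX (hT hB) hyB
  · intro Y hY
    rw [mem_subpolymers] at hY
    rw [mem_powerset]
    intro B hB
    obtain ⟨y, hy, rfl⟩ := exists_eq_block_of_mem_blocksOf hB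
    exact mem_image_of_mem _ (hY.1 hy)
  · intro T hT
    rw [mem_powerset] at hT
    exact blocksOf_biUnion_subset hT
  · intro Y hY
    rw [mem_subpolymers] at hY
    exact hY.2.eq_biUnion.symm
  · intro T hT
    rw [mem_powerset] at hT
    have hTp : IsPolymer b (T.biUnion id) := isPolymer_biUnion_of_subset_blocksOf hT
    have hsub : T.biUnion id ⊆ X := by
      intro y hy
      obtain ⟨B, hB, hyB⟩ := mem_biUnion.1 hy
      exact subset_of_mem_blocksOf hX (hT hB) hyB
    rw [blocksOf_biUnion_subset hT, blocksOf_sdiff hX hTp hsub, blocksOf_biUnion_subset hT]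

/-- The circle product only sees the values of its first factor on polymers. [folklore] -/
theorem circ_congr_left {F F' G : Finset (TorusSite d M) → R} (h : ∀ X, IsPolymer b X → F X = F' X)
    (Y : Finset (TorusSite d M)) : circ b F G Y = circ b F' G Y := by
  unfold circ
  exact Finset.sum_congr rfl fun X hX => by rw [h X (mem_subpolymers.1 hX).2]

/-- The circle product only sees the values of its second factor on polymers (for a polymer
argument). [folklore] -/
theorem circ_congr_right {F G G' : Finset (TorusSite d M) → R} (h : ∀ X, IsPolymer b X → G X = G' X)
    {Y : Finset (TorusSite d M)} (hY : IsPolymer b Y) : circ b F G Y = circ b F G' Y := by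
  unfold circ
  exact Finset.sum_congr rfl fun X hX => by rw [h (Y \ X) (hY.sdiff (mem_subpolymers.1 hX).2)]

/-- **[BS-rg-step] Map 2 (transfer from block to `V`), algebraic part (Lemma 4.3.1 (i))**: with
`δI = I - Î` (as block activities) and `K^{(2)} = K^{(1)} ∘ δI`, one has
`(I ∘ K^{(1)})(Λ) = (Î ∘ K^{(2)})(Λ)` — by the binomial lemma and associativity/commutativity of
`∘`: "`I ∘ K^{(1)} = (Î + δI) ∘ K^{(1)} = (Î ∘ δI) ∘ K^{(1)} = Î ∘ (δI ∘ K^{(1)})`". Stated on any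
polymer `Y` (the paper uses `Y = Λ`). [cite: BrydgesSlade2015RGV, §4.3, (4.27) (definition of I^{(2)}, δI^{(2)}, K^{(2)}) and Lemma (lem:K2) (i)] -/
theorem circ_blockProd_eq_circ_blockProd_circ_sub (I Ihat K : Finset (TorusSite d M) → R)
    {Y : Finset (TorusSite d M)} (hY : IsPolymer b Y) :
    circ b (blockProd b I) K Y = circ b (blockProd b Ihat) (circ b K (blockProd b (I - Ihat))) Y := by
  have e : I = Ihat + (I - Ihat) := by abel
  conv_lhs => rw [e]
  rw [circ_congr_left (fun X hX => blockProd_add Ihat (I - Ihat) hX), circ_assoc]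
  exact circ_congr_right (fun X hX => circ_comm _ _ hX) hY

end Binomial

/-! ## Two scales: block refinement and the closure `X̄` -/

section TwoScales

variable {b b' : ℕ}

omit [NeZero M] in
/-- If `b ∣ b'`, the `b`-block key determines the `b'`-block key. [folklore] -/
theorem blockKey_eq_of_dvd (hbb : b ∣ b') {x y : TorusSite d M} (h : blockKey b y = blockKey b x) :
    blockKey b' y = blockKey b' x := by
  obtain ⟨c, rfl⟩ := hbb
  funext i
  have := congrFun h i
  simp only [blockKey] at this ⊢
  rw [← Nat.div_div_eq_div_mul, ← Nat.div_div_eq_div_mul, this]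

/-- **Blocks refine coarser blocks**: for `b ∣ b'`, `B_b(x) ⊆ B_{b'}(x)` ("the torus … paved … by
disjoint cubes of side `L^j`", nested in `j`). [cite: BrydgesSlade2015RGV, §1.2, Definition (a) (blocks)] -/
theorem block_subset_block_of_dvd (hbb : b ∣ b') (x : TorusSite d M) : block b x ⊆ block b' x := by
  intro y hy
  rw [mem_block] at hy ⊢
  exact blockKey_eq_of_dvd hbb hy

/-- A coarse polymer is a fine polymer. [folklore] -/
theorem IsPolymer.of_dvd (hbb : b ∣ b') {X : Finset (TorusSite d M)} (hX : IsPolymer b' X) : IsPolymer b X :=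
  fun x hx => (block_subset_block_of_dvd hbb x).trans (hX hx)

/-- The closure `X̄`: the smallest `b'`-polymer containing `X` ("The closure `X̄` of `X ∈ 𝒫_j` is
the smallest `Y ∈ 𝒫_{j+1}` such that `X ⊂ Y`"). [cite: BrydgesSlade2015RGV, §1.5, Definition (def:blocks1) (closure, 𝒫̄_j(U))] -/
def bclosure (b' : ℕ) (X : Finset (TorusSite d M)) : Finset (TorusSite d M) := X.biUnion (block b')

/-- `X ⊆ X̄`. [folklore] -/
theorem subset_bclosure (b' : ℕ) (X : Finset (TorusSite d M)) : X ⊆ bclosure b' X := fun x hx =>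
  mem_biUnion.2 ⟨x, hx, mem_block_self b' x⟩

/-- `X̄` is a `b'`-polymer. [folklore] -/
theorem isPolymer_bclosure (b' : ℕ) (X : Finset (TorusSite d M)) : IsPolymer b' (bclosure b' X) := by
  intro y hy z hz
  obtain ⟨x, hx, hyx⟩ := mem_biUnion.1 hy
  refine mem_biUnion.2 ⟨x, hx, ?_⟩
  rw [← block_eq_of_mem hyx]
  exact hz

/-- `X̄ ⊆ U` for every `b'`-polymer `U ⊇ X` (minimality). [folklore] -/
theorem bclosure_subset {X U : Finset (TorusSite d M)} (hU : IsPolymer b' U) (hXU : X ⊆ U) : bclosure b' X ⊆ U := by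
  intro y hy
  obtain ⟨x, hx, hyx⟩ := mem_biUnion.1 hy
  exact hU (hXU hx) hyx

/-- `X̄ = X` for a `b'`-polymer. [folklore] -/
theorem IsPolymer.bclosure_eq {X : Finset (TorusSite d M)} (hX : IsPolymer b' X) : bclosure b' X = X :=
  Subset.antisymm (bclosure_subset hX (subset_refl X)) (subset_bclosure b' X)

open Classical in
/-- `𝒫̄_j(U) = {X ∈ 𝒫_j : X̄ = U}`. [cite: BrydgesSlade2015RGV, §1.5, Definition (def:blocks1)] -/
def closureFiber (b b' : ℕ) (U : Finset (TorusSite d M)) : Finset (Finset (TorusSite d M)) :=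
  (subpolymers b U).filter fun X => bclosure b' X = U

/-- Membership in `𝒫̄_j(U)`. [folklore] -/
@[simp] theorem mem_closureFiber {U X : Finset (TorusSite d M)} :
    X ∈ closureFiber b b' U ↔ IsPolymer b X ∧ bclosure b' X = U := by
  classical
  simp only [closureFiber, mem_filter, mem_subpolymers]
  constructor
  · rintro ⟨⟨-, h1⟩, h2⟩; exact ⟨h1, h2⟩
  · rintro ⟨h1, h2⟩; exact ⟨⟨h2 ▸ subset_bclosure b' X, h1⟩, h2⟩

/-- `F^{Λ ∖ V} = F^{Λ ∖ W} F^{W ∖ V}` for polymers `V ⊆ W`. [folklore] -/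
theorem blockProd_univ_sdiff {R : Type*} [CommMonoid R] (F : Finset (TorusSite d M) → R)
    {V W : Finset (TorusSite d M)} (hV : IsPolymer b V) (hW : IsPolymer b W) (h : V ⊆ W) :
    blockProd b F (univ \ V) = blockProd b F (univ \ W) * blockProd b F (W \ V) := by
  have e : univ \ V = (univ \ W) ∪ (W \ V) := by
    ext x
    simp only [mem_sdiff, mem_univ, true_and, mem_union]
    constructor
    · intro hx
      by_cases hW : x ∈ W
      · exact Or.inr ⟨hW, hx⟩
      · exact Or.inl hW
    · rintro (hx | ⟨-, hx⟩)
      · exact fun h' => hx (h h')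
      · exact hx
  rw [e, blockProd_union F ((isPolymer_univ b).sdiff hW) (hW.sdiff hV)]
  exact disjoint_left.2 fun x hx hx' => (mem_sdiff.1 hx).2 (mem_sdiff.1 hx').1

end TwoScales

/-! ## Map 3: expansion, expectation and change of scale ([BS-rg-step] Proposition 5.1.1) -/

section MapThree

variable {A N : Type*} [CommRing A] [CommRing N]

/-- A ring homomorphism acts on `F^X` blockwise. [folklore] -/
theorem map_blockProd (f : A →+* N) (b : ℕ) (F : Finset (TorusSite d M) → A) (X : Finset (TorusSite d M)) :
    f (blockProd b F X) = blockProd b (fun B => f (F B)) X := by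
  unfold blockProd
  rw [map_prod]

/-- A ring homomorphism acts on a circle product factorwise. [folklore] -/
theorem map_circ (f : A →+* N) (b : ℕ) (F G : Finset (TorusSite d M) → A) (Y : Finset (TorusSite d M)) :
    f (circ b F G Y) = circ b (fun X => f (F X)) (fun X => f (G X)) Y := by
  unfold circ
  rw [map_sum]
  simp only [map_mul]

variable (b b' : ℕ) (ι θ : A →+* N) (E : N → A)

/-- `δI = θÎ - Ĩ_pt` as a block activity with values in the big algebra (functions of the field
and of the fluctuation field): "`δI = θ I^{(2)} - I^{(3)} = θÎ - Ĩ_pt`", with `Ĩ_pt(b) ∈ 𝒩` embedded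
by `ι` (no fluctuation field). [cite: BrydgesSlade2015RGV, §5.1, (e:dIdef) "δI = θÎ − Ĩ_pt"] -/
def deltaI (Ihat Itil : Finset (TorusSite d M) → A) (B : Finset (TorusSite d M)) : N := θ (Ihat B) - ι (Itil B)

/-- **`K^{(3)}`** ([BS-rg-step] (e:EIK2)):
`K^{(3)}(U) = Σ_{X ∈ 𝒫̄_j(U)} Ĩ_pt^{U∖X} 𝔼₊(δI ∘ θK^{(2)})(X)` for `U ∈ 𝒫_{j+1}`; here `b = L^j`,
`b' = L^{j+1}`, `E = 𝔼₊`, and `θK(X) = θ(K(X))`. [cite: BrydgesSlade2015RGV, §5.1, Proposition (prop:K3), display (e:EIK2)] -/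
def kthree (Ihat Itil : Finset (TorusSite d M) → A) (K : Finset (TorusSite d M) → A) (U : Finset (TorusSite d M)) : A :=
  ∑ X ∈ closureFiber b b' U,
    blockProd b Itil (U \ X) * E (circ b (blockProd b (deltaI ι θ Ihat Itil)) (fun Y => θ (K Y)) X)

/-- **[BS-rg-step] Proposition 5.1.1 (Map 3: expansion, expectation, change of scale), the
identity (e:EIK1)**: `𝔼₊θ(Î ∘ K^{(2)})(Λ) = (Ĩ_pt ∘ K^{(3)})(Λ)`, where on the right the circle
product is at scale `j+1` and `Ĩ_pt(B) = ∏_{b ∈ ℬ_j(B)} Ĩ_pt(b)` for `(j+1)`-blocks `B`.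
Hypotheses, abstracting "There is no `θ` operating on `Ĩ_pt`, and this factor contains no
fluctuation fields upon which `𝔼₊` can act": `θ, ι : 𝒩 → 𝒩̃` are ring maps (`θF(φ,ζ) = F(φ+ζ)`,
`ιF(φ,ζ) = F(φ)`), and `E : 𝒩̃ → 𝒩` is `𝒩`-linear on finite combinations `Σ ι(a_i) n_i` of elements
`n_i` satisfying `P` (integrability), with every `(δI ∘ θK)(Y)` satisfying `P`; scales `b ∣ b'`.
Proof as printed: `θÎ(B) = Ĩ_pt(B) + δI(B)` and the binomial lemma give
`θ(Î ∘ K) = Ĩ_pt ∘ δI ∘ θK`; pull `Ĩ_pt^{Λ∖Y}` out of `𝔼₊`; regroup `Y` by `U = Ȳ` using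
`Ĩ_pt^{Λ∖Y} = Ĩ_pt^{U∖Y} Ĩ_pt^{Λ∖U}`. [cite: BrydgesSlade2015RGV, §5.1, Proposition (prop:K3) (e:EIK1)–(e:EIK2) and its proof] -/
theorem expect_theta_circ_eq_circ_kthree (hbb : b ∣ b') (P : N → Prop)
    (hE : ∀ (s : Finset (Finset (TorusSite d M))) (a : Finset (TorusSite d M) → A) (n : Finset (TorusSite d M) → N),
      (∀ i ∈ s, P (n i)) → E (∑ i ∈ s, ι (a i) * n i) = ∑ i ∈ s, a i * E (n i))
    (Ihat Itil : Finset (TorusSite d M) → A) (K : Finset (TorusSite d M) → A)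
    (hP : ∀ Y, IsPolymer b Y → P (circ b (blockProd b (deltaI ι θ Ihat Itil)) (fun X => θ (K X)) Y)) :
    E (θ (circ b (blockProd b Ihat) K univ)) = circ b' (blockProd b Itil) (kthree b b' ι θ E Ihat Itil K) univ := by
  classical
  rw [circ_comm (blockProd b Itil) (kthree b b' ι θ E Ihat Itil K) (isPolymer_univ b')]
  -- Step 1: `θ(Î ∘ K) = (θÎ) ∘ (θK)` and `θÎ = ιĨ + δI`, binomial lemma, associativity
  rw [map_circ]
  have e1 : (fun X => θ (blockProd b Ihat X)) = blockProd b (fun B => θ (Ihat B)) := by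
    funext X; exact map_blockProd θ b Ihat X
  have e2 : (fun B => θ (Ihat B)) = (fun B => ι (Itil B)) + deltaI ι θ Ihat Itil := by
    funext B; simp [deltaI]
  rw [e1, e2, circ_congr_left (fun X hX => blockProd_add (fun B => ι (Itil B)) (deltaI ι θ Ihat Itil) hX), circ_assoc,
    circ_comm _ _ (isPolymer_univ b)]
  -- Step 2: pull the `Ĩ_pt` factors out of `E`
  unfold circ
  have e3 : ∀ Y ∈ subpolymers b univ,
      (∑ X ∈ subpolymers b Y, blockProd b (deltaI ι θ Ihat Itil) X * θ (K (Y \ X))) *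
          blockProd b (fun B => ι (Itil B)) (univ \ Y) =
        ι (blockProd b Itil (univ \ Y)) * circ b (blockProd b (deltaI ι θ Ihat Itil)) (fun X => θ (K X)) Y := by
    intro Y _
    rw [map_blockProd, mul_comm]
    rfl
  rw [Finset.sum_congr rfl e3, hE _ _ _ fun Y hY => hP Y (mem_subpolymers.1 hY).2]
  -- Step 3: regroup by the closure `U = Ȳ` at scale `b'`
  rw [← Finset.sum_fiberwise_of_maps_to (s := subpolymers b univ) (t := subpolymers b' univ) (g := bclosure b')
    (fun Y _ => mem_subpolymers.2 ⟨subset_univ _, isPolymer_bclosure b' Y⟩)]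
  unfold kthree
  refine Finset.sum_congr rfl fun U hU => ?_
  have hUp : IsPolymer b' U := (mem_subpolymers.1 hU).2
  rw [Finset.sum_mul]
  have hset : (subpolymers b univ).filter (fun Y => bclosure b' Y = U) = closureFiber b b' U := by
    ext Y
    simp only [mem_filter, mem_subpolymers, mem_closureFiber, subset_univ, true_and]
  rw [hset]
  refine Finset.sum_congr rfl fun Y hY => ?_
  obtain ⟨hYp, hYU⟩ := mem_closureFiber.1 hY
  have hYsub : Y ⊆ U := hYU ▸ subset_bclosure b' Y
  rw [blockProd_univ_sdiff Itil hYp (hUp.of_dvd hbb) hYsub]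
  ring

end MapThree

end Polymer

end LongRangePhi4

end Literature.Barriers.CriticalPhenomena
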